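import Summits.BirchSwinnertonDyer.Rank1Residual.X11b.KolyvaginH44Concrete
import Mathlib.Tactic.Module
import HarnessLib

/-!
# Kolyvagin–Heegner data at one level: the auxiliary embedding, and `Γ_K` acting trivially on classes

Team x11b3 (N8/O2), leaf (A′) of the Kolyvagin finiteness assembly, item (A′-glob) road (g3) —
x11b3-p2 GEN 12, offer (P2-CHOICE) FILE B, first half B1 (lead GEN 11, R12-31 (2) / R12-34; split from
B2 `X11b/KolyvaginClassChoiceConcrete.lean` by the 400-line cap only).  Summit-side THEOREM-ONLY file
(no definition, no named fact, no `sorry`); `K : Type`; curve-level TOOL lemmas, generic `K`, generic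
`n : ℤ`, no Kolyvagin hypothesis, nothing `p = 3`-specific.

HONEST FRAMING (cell rule, binding): plumbing.  The tree's `KolyvaginHeegnerData Dt β ι k`
(`Literature/…/HeegnerPointsOfConductor.lean`) packages, besides the CANONICAL point `y(k) ∈ E(K[k])`
(pinned by `map_y`), three AUXILIARY CHOICES (generators `σ_q`, transversal `S`, embedding
`emb : K[k] → K̄`).  This half handles the embedding: two data at one level have the same `y(k)`, their
embeddings `E(K[k]) → E(K̄)` differ by some `γ ∈ Γ_K` and have the same image, and Kolyvagin's class is
blind to `γ` — the structure's docstring remark *"any two differ by `Γ_K`, which acts trivially on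
`H¹(K, ·)`"* made a theorem (`IsLiftOfAut.conjAct_kolyvaginClass` + `conjAct_one`; Serre, *Local
Fields*, VII.§5 Prop. 3).  Gross 1991, §4 (4.2)–(4.4): the diagram of `Gal(K̄/K)`-modules with
`E(K_n)`. (γ) / (A′-53) / [GZ86 III (3.1)] / `hpoints` / `h44` / (R)_M are NOT touched; nothing is
booked; no mark / label / count moves.

## What is proved (namespace `Summit.BirchSwinnertonDyer.Rank1Residual.X11b.KolyvaginChoice`)

* `exists_absGal_smul_eq` — two `K`-algebra maps `K[k] → K̄` differ by an element of `Γ_K`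
  (Mathlib `AlgHom.liftNormal`, `AlgHom.normal_bijective`).
* `y_eq` — **the 'same `y`' lemma**: two data at the same level have the SAME
  `y(k)` (`map_y` + Mathlib `WeierstrassCurve.Affine.Point.map_injective`).
* `exists_toGeomPoints_eq_smul` — `d'.toGeomPoints Q = γ • d.toGeomPoints Q`.
* `pointsSubgroup_eq` — `d'.pointsSubgroup = d.pointsSubgroup`.
* `smul_mem_invPoints` — `invPoints` is `Γ`-stable for an admissible `A`.
* `kolyvaginClass_smul_eq` — `c(γ • P) = c(P)` in `H¹(K, E[n])` for `γ ∈ Γ_K`.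
* `zsmul_mem_iff_of_isCoprime` — `t • c' ∈ H ↔ t • c ∈ H` when `c' = u • c`, `u` prime to an
  exponent `n` of `c`.

## References

* [GrossLMS1991] B. H. Gross, *Kolyvagin's work on modular elliptic curves*, LMS LNS 153 (1991): §3
  (`y_n ∈ E(K_n)`, chunk 217 L1), §4 (4.2)–(4.4).
* [SerreLocalFields1979] J.-P. Serre, *Local Fields*, VII.§5 Prop. 3.

## Mathlib / tree search

Tree: x11b3-p2 `KolyvaginH44.exists_absGaloisRestrict`, `KolyvaginHeegnerData.toGeomPoints_pointGalHom`,
`KolyvaginH44.kolyvaginClass_congr`; Literature `IsLiftOfAut.conjAct_kolyvaginClass`, `conjAct_one`,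
`absoluteGaloisGroup.toAlgEquiv_symm_apply`, `KolyvaginCocycle.smul_zsmul_comm`.  Mathlib:
`AlgHom.liftNormal(_commutes)`, `AlgHom.normal_bijective`, `AlgHom.mem_fieldRange`,
`Affine.Point.map_injective`, `Affine.Point.map_some`, tactic `module`.  `lean search
'exists_absGal_smul_eq|KolyvaginClassChoice|pointsSubgroup_eq'` → no matches (INTENT-grep).
-/

noncomputable section

open scoped Classical
open WeierstrassCurve Field NumberField IsDedekindDomain Finset
open Literature.NumberTheory.EllipticCurves Literature.NumberTheory.GaloisRepresentations
open Literature.NumberTheory.EllipticCurves.KolyvaginCocycle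
open Literature.NumberTheory.EllipticCurves.KolyvaginEuler
open Literature.NumberTheory.EllipticCurves.RingClassField
open Literature.NumberTheory.EllipticCurves.ModularForms

namespace Summit.BirchSwinnertonDyer.Rank1Residual.X11b.KolyvaginChoice

-- `K : Type`: the tree's ring-class class field theory is universe `0`.
variable {K : Type} [Field K] [NumberField K]

/-! ## §1 Two `K`-embeddings `K[k] → K̄` differ by `Γ_K` -/

/-- **Two `K`-embeddings of `K[k]` into `K̄` differ by an element of `Γ_K`** (`K̄/K` is normal:
extend `e' ∘ e⁻¹` from `e(K[k])` to `K̄`, Mathlib `AlgHom.liftNormal`).  This is the remark *"any two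
differ by `Γ_K`"* of the docstring of `KolyvaginHeegnerData`. [folklore] -/
theorem exists_absGal_smul_eq (ι : K →+* ℂ) (k : ℕ)
    (e e' : ringClassField K ι k →ₐ[K] AlgebraicClosure K) :
    ∃ γ : absoluteGaloisGroup K, ∀ x, γ • e x = e' x := by
  letI : Algebra (ringClassField K ι k) (AlgebraicClosure K) := e.toRingHom.toAlgebra
  haveI : IsScalarTower K (ringClassField K ι k) (AlgebraicClosure K) :=
    IsScalarTower.of_algebraMap_eq fun x ↦ (e.commutes x).symm
  have halg : ∀ x, algebraMap (ringClassField K ι k) (AlgebraicClosure K) x = e x := fun _ ↦ rfl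
  let F : IntermediateField K (AlgebraicClosure K) := e'.fieldRange
  let ϕ : ringClassField K ι k →ₐ[K] F :=
    { toFun := fun x ↦ ⟨e' x, e'.mem_fieldRange.mpr ⟨x, rfl⟩⟩
      map_one' := Subtype.ext (by simp)
      map_mul' := fun a b ↦ Subtype.ext (by simp)
      map_zero' := Subtype.ext (by simp)
      map_add' := fun a b ↦ Subtype.ext (by simp)
      commutes' := fun r ↦ Subtype.ext (by simp) }
  have hϕ : ∀ x, ((ϕ x : F) : AlgebraicClosure K) = e' x := fun _ ↦ rfl
  let γ₀ : AlgebraicClosure K →ₐ[K] AlgebraicClosure K := ϕ.liftNormal (AlgebraicClosure K)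
  have hγ₀ : ∀ x, γ₀ (e x) = e' x := fun x ↦ by
    rw [← halg, ← hϕ]
    exact ϕ.liftNormal_commutes (AlgebraicClosure K) x
  let γ₁ : AlgebraicClosure K ≃ₐ[K] AlgebraicClosure K :=
    AlgEquiv.ofBijective γ₀
      (AlgHom.normal_bijective K (AlgebraicClosure K) (AlgebraicClosure K) γ₀)
  refine ⟨(absoluteGaloisGroup.toAlgEquiv K).symm γ₁, fun x ↦ ?_⟩
  rw [absoluteGaloisGroup.toAlgEquiv_symm_apply]
  exact hγ₀ x

/-! ## §2 Two data at one level: same `y`, embeddings differing by `Γ_K`, same `E(K_k) ⊆ E(K̄)` -/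

section Data

variable {N : ℕ} [NeZero N] {W : WeierstrassCurve ℚ} {Dt : ModularParametrizationData W N} {β : ℤ}
  {ι : K →+* ℂ} {k : ℕ}

/-- **The point `y(k)` is canonical**: two Kolyvagin–Heegner data at the same level have the same
`y`, since both map to `φ(x(k)) ∈ E(ℂ)` (`map_y`) and `E(K[k]) → E(ℂ)` is injective (Gross 1991, §3:
*"the point `x_n` is rational over `K_n`"* — one point). [cite: GrossLMS1991, §3 (chunk 217 L1)] -/
theorem y_eq
    (d d' : KolyvaginHeegnerData Dt β ι k) : d'.y = d.y :=
  WeierstrassCurve.Affine.Point.map_injective (ringClassField K ι k).subtype.toRatAlgHom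
    (d'.map_y.trans d.map_y.symm)

/-- **The two embeddings `E(K[k]) → E(K̄)` differ by some `γ ∈ Γ_K`**: `d'.toGeomPoints Q =
γ • d.toGeomPoints Q` for all `Q ∈ E(K[k])` (coordinatewise, from `exists_absGal_smul_eq`).
[folklore] -/
theorem exists_toGeomPoints_eq_smul
    (d d' : KolyvaginHeegnerData Dt β ι k) :
    ∃ γ : absoluteGaloisGroup K, ∀ Q, d'.toGeomPoints Q = γ • d.toGeomPoints Q := by
  let e : ringClassField K ι k →ₐ[K] AlgebraicClosure K := { d.emb with commutes' := d.emb_apply }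
  let e' : ringClassField K ι k →ₐ[K] AlgebraicClosure K := { d'.emb with commutes' := d'.emb_apply }
  obtain ⟨γ, hγ⟩ := exists_absGal_smul_eq ι k e e'
  have hγ' : ∀ x, γ • d.emb x = d'.emb x := hγ
  refine ⟨γ, fun Q ↦ ?_⟩
  rcases Q with _ | ⟨x, y, hxy⟩
  · change d'.toGeomPoints 0 = γ • d.toGeomPoints 0
    rw [map_zero, map_zero, smul_zero]
  · have hns : ((W.baseChange K).baseChange (AlgebraicClosure K)).toAffine.Nonsingular
        (d.emb x) (d.emb y) :=
      (Affine.baseChange_nonsingular W d.emb.toRatAlgHom.injective x y).mpr hxy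
    have hns' : ((W.baseChange K).baseChange (AlgebraicClosure K)).toAffine.Nonsingular
        (d'.emb x) (d'.emb y) :=
      (Affine.baseChange_nonsingular W d'.emb.toRatAlgHom.injective x y).mpr hxy
    have lhs : d'.toGeomPoints (.some x y hxy) = Affine.Point.some (d'.emb x) (d'.emb y) hns' := by
      change Affine.Point.map (W' := W) d'.emb.toRatAlgHom (.some x y hxy) = _
      rw [Affine.Point.map_some]
      rfl
    have rhs : γ • d.toGeomPoints (.some x y hxy) = Affine.Point.some (d'.emb x) (d'.emb y) hns' := by
      have h1 : d.toGeomPoints (.some x y hxy) =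
          Affine.Point.map (W' := W) d.emb.toRatAlgHom (.some x y hxy) := rfl
      rw [h1, Affine.Point.map_some]
      change Affine.Point.map (W' := W.baseChange K)
          ((absoluteGaloisGroup.toAlgEquiv K γ : AlgebraicClosure K ≃ₐ[K] AlgebraicClosure K) :
            AlgebraicClosure K →ₐ[K] AlgebraicClosure K)
          (Affine.Point.some (d.emb x) (d.emb y) hns) = _
      rw [Affine.Point.map_some]
      simp only [Affine.Point.some.injEq, AlgEquiv.coe_toAlgHom]
      exact ⟨hγ' x, hγ' y⟩
    rw [lhs, rhs]

/-- **The image `E(K_k) ⊆ E(K̄)` does not depend on the embedding**: `d'.pointsSubgroup =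
d.pointsSubgroup` — the two embeddings differ by `γ ∈ Γ_K`, and `E(K_k) ⊆ E(K̄)` is `Γ_K`-stable
(`K[k]/K` is Galois: `exists_absGaloisRestrict` + `toGeomPoints_pointGalHom`). Gross 1991, §4
(4.2)–(4.4) (`E(K_n)` as a `Gal(K̄/K)`-set). [cite: GrossLMS1991, §4 (4.2)–(4.4)] -/
theorem pointsSubgroup_eq
    (hK : IsImaginaryQuadratic K) (d d' : KolyvaginHeegnerData Dt β ι k) :
    d'.pointsSubgroup = d.pointsSubgroup := by
  -- `Γ_K`-stability of the image of any datum's embedding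
  have hstab : ∀ (d₀ : KolyvaginHeegnerData Dt β ι k) (τ : absoluteGaloisGroup K),
      ∀ P ∈ d₀.pointsSubgroup, τ • P ∈ d₀.pointsSubgroup := by
    intro d₀ τ P hP
    obtain ⟨Q, rfl⟩ := hP
    let e : ringClassField K ι k →ₐ[K] AlgebraicClosure K := { d₀.emb with commutes' := d₀.emb_apply }
    obtain ⟨π, hπ⟩ := KolyvaginH44.exists_absGaloisRestrict hK ι k e
    refine ⟨pointGalHom W (ringClassField K ι k)
      (π τ : ringClassField K ι k ≃ₐ[ℚ] ringClassField K ι k) Q, ?_⟩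
    exact d₀.toGeomPoints_pointGalHom (fun x ↦ hπ τ x) Q
  obtain ⟨γ, hγ⟩ := exists_toGeomPoints_eq_smul d d'
  ext P
  constructor
  · rintro ⟨Q, rfl⟩
    change d'.toGeomPoints Q ∈ d.pointsSubgroup
    rw [hγ]
    exact hstab d γ _ ⟨Q, rfl⟩
  · rintro ⟨Q, rfl⟩
    change d.toGeomPoints Q ∈ d'.pointsSubgroup
    have h : d.toGeomPoints Q = γ⁻¹ • d'.toGeomPoints Q := by
      rw [hγ, inv_smul_smul]
    rw [h]
    exact hstab d' γ⁻¹ _ ⟨Q, rfl⟩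

end Data

/-! ## §3 `Γ_K` acts trivially on Kolyvagin's classes; unit scaling and subgroups -/

/-- `invPoints` is stable under the group: if `P ∈ A` with `(g-1)P ∈ nA` for all `g`, then
`γ • P` has the same property (`(g-1)(γP) = γ((γ⁻¹gγ - 1)P)`, `A` being `G`-stable). [folklore] -/
theorem smul_mem_invPoints {G : Type*} [Group G] {M : Type*} [AddCommGroup M] [DistribMulAction G M]
    {A : AddSubgroup M} {nn : ℤ} (hA : IsAdmissible G A nn) (γ : G) {P : M}
    (hP : P ∈ invPoints G A nn) : γ • P ∈ invPoints G A nn := by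
  refine ⟨hA.smul_mem γ hP.1, fun g ↦ ?_⟩
  obtain ⟨R, hR, hRe⟩ := hP.2 (γ⁻¹ * g * γ)
  refine ⟨γ • R, hA.smul_mem γ hR, ?_⟩
  have hconj : γ * (γ⁻¹ * g * γ) = g * γ := by group
  rw [← smul_zsmul_comm γ, hRe, smul_sub, ← mul_smul, hconj, mul_smul]

/-- **`c(γ • P) = c(P)` in `H¹(K, E[n])` for `γ ∈ Γ_K`** (relative to a `Γ_K`-stable admissible
`A`): `γ` is a lift of `1 ∈ Aut(K/ℚ)`, so by `IsLiftOfAut.conjAct_kolyvaginClass` the class of `γ • P`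
is `conjAct W 1 n` of the class of `P`, and `conjAct_one` (inner automorphisms act trivially on
`H¹`; Serre, *Local Fields*, VII.§5 Prop. 3). [cite: SerreLocalFields1979, VII.§5 Prop. 3] -/
theorem kolyvaginClass_smul_eq {W : WeierstrassCurve ℚ} {nn : ℤ}
    {hdiv : ∀ Q : geomPoints (W.baseChange K), ∃ R : geomPoints (W.baseChange K), nn • R = Q}
    {A : AddSubgroup (geomPoints (W.baseChange K))}
    (hA : IsAdmissible (absoluteGaloisGroup K) A nn) (γ : absoluteGaloisGroup K)
    {P : geomPoints (W.baseChange K)} (hP : P ∈ invPoints (absoluteGaloisGroup K) A nn)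
    (hP' : γ • P ∈ invPoints (absoluteGaloisGroup K) A nn) :
    kolyvaginClass (W.baseChange K) nn hdiv hA (γ • P) hP' =
      kolyvaginClass (W.baseChange K) nn hdiv hA P hP := by
  have hτ : IsLiftOfAut (1 : K ≃ₐ[ℚ] K)
      ((absoluteGaloisGroup.toAlgEquiv K γ : AlgebraicClosure K ≃ₐ[K] AlgebraicClosure K) :
        AlgebraicClosure K ≃+* AlgebraicClosure K) := fun x ↦ by
    rw [AlgEquiv.one_apply]
    exact (absoluteGaloisGroup.toAlgEquiv K γ).commutes x
  have hpm : ∀ Q : geomPoints (W.baseChange K), hτ.pointsMap W Q = γ • Q := by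
    intro Q
    change ((W.baseChange K).baseChange (AlgebraicClosure K)).toAffine.Point at Q
    rcases Q with _ | ⟨x, y, h⟩
    · rfl
    · rfl
  have hAτ : ∀ a ∈ A, hτ.pointsMap W a ∈ A := fun a ha ↦ by
    rw [hpm]
    exact hA.smul_mem γ ha
  have hP'' : hτ.pointsMap W P ∈ invPoints (absoluteGaloisGroup K) A nn := by
    rw [hpm]
    exact hP'
  have h := hτ.conjAct_kolyvaginClass W (hdiv := hdiv) hA hAτ hP hP''
  rw [conjAct_one, AddMonoidHom.id_apply] at h
  rw [h]
  exact KolyvaginH44.kolyvaginClass_congr rfl (hpm P).symm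

/-- **Unit scaling does not change membership of multiples in a subgroup**: if `c' = u • c` with
`u` prime to `n` and `n • c = 0`, then `t • c' ∈ H ↔ t • c ∈ H` for every integer `t` and every
subgroup `H` (`c = v • c'` for `v u ≡ 1 (mod n)`). [folklore] -/
theorem zsmul_mem_iff_of_isCoprime {X : Type*} [AddCommGroup X] {H : AddSubgroup X} {c c' : X}
    {u n : ℤ} (hu : IsCoprime u n) (hn : n • c = 0) (hc' : c' = u • c) (t : ℤ) :
    t • c' ∈ H ↔ t • c ∈ H := by
  constructor
  · intro h
    obtain ⟨v, w, hvw⟩ := hu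
    have key : t • c = v • (t • c') + (w * t) • (n • c) := by
      rw [hc']
      calc t • c = (v * u + w * n) • (t • c) := by rw [hvw, one_smul]
        _ = v • (t • (u • c)) + (w * t) • (n • c) := by module
    rw [key, hn, smul_zero, add_zero]
    exact H.zsmul_mem h v
  · intro h
    rw [hc', smul_comm]
    exact H.zsmul_mem h u

end Summit.BirchSwinnertonDyer.Rank1Residual.X11b.KolyvaginChoice

end
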